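import Literature.NumberTheory.EllipticCurves.LiLiuTian2024.CongruentNumberFullBSD
import HarnessLib

/-!
# Tian–Yuan–Zhang 2017 (Asian J. Math. 21), *Genus periods, genus points and congruent number problem*: the invariant `𝓛(n)`, Thm. 1.1, Thm. 1.2, Cor. 1.4 AS PRINTED — the parity (= the prime `2`) of the BSD quotient of `E_n : ny² = x³ − x`

**ERRATUM (F-Σ2, 2026-08-22; p2-idea-2's reading finding, two-author check by this seat = the
original typer).** The GEN-1 transcription `genusSum₂` of the SECOND genus sum of Thm. 1.2 requires two
DISTINCT factors `d₀ ≠ d₁` and therefore OMITS the trivial decomposition `D = {n}` (`ℓ = 0`), which the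
printed sum INCLUDES (the conditions on `d₁`, `dᵢ` are vacuous at `ℓ = 0`; the proof is explicit:
Prop. 3.4's proof, chunk p0016 L146 "the contribution by `d₀ = d₀″ = n, d₁ = 1` is the single term
`Z(n)`", p0017 L58 "for the case `d₁ ≡ 1 (mod 8)`, we are only left with `d₁ = 1`", Lemma 3.21 p0020
L27–L41 and the displayed congruence p0020 L124–L141 / p0021 L3, where `g(n)` sits inside the bracket of
residue `n mod 8`).  Consequently `thm12_parity_of_scriptL` AS TYPED is STRONGER than print in its `Σ₂`
clauses and is MIS-STATED (p2-idea-2 exhibits 174 square-free `n < 3·10⁶` on which, modulo GZK, it is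
refuted by rank-`3` data — EVIDENCE, `p2/idea-2/SIGMA2-READING-NOTE.md`).  REPAIR (§5 below, additive —
the old declarations are referenced by consumers and keep their names and bodies): `genusSum₂'` (the
printed filter: `{n}` qualifies), `thm12_parity_of_scriptL'` (the theorem AS PRINTED), and the PROVED
bridge `genusSum₂'_eq_genusSum₂_add_self : genusSum₂' n g = genusSum₂ n g + g n` (`1 < n ≡ 5, 6, 7`).
`genusSum₁`, `thm11_parity_of_scriptL`, `cor14_congruent_criteria` are faithful.  Every consumer that fed
`thm12_parity_of_scriptL` ONLY the first sum `Σ₁` obtains the same conclusion from the primed fact.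

HONEST FRAMING (cell `b2b-bsdres`, sub-lane `bsd-p2`, run/shared/lean/b2b/bsd-rank1-residual/p2/;
literature typer 1, mandate (iv)): PUBLISHED theorems vendored as named `Prop`s (nothing asserted,
nothing discharged; D-0014), every printed hypothesis a binder, locators into the held text. This is
EVIDENCE of what print says 2-adically for ONE quadratic-twist family (the congruent number curves,
CM by `ℤ[i]`, conductor `32 n²` or `16 n²`); nothing booked; no mark moved.

Source. Y. Tian, X. Yuan, S.-W. Zhang, *Genus periods, genus points and congruent number problem*,
Asian J. Math. **21** (2017), no. 4, 721–774, doi:10.4310/ajm.2017.v21.n4.a5 = arXiv:1411.4728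
[TianYuanZhang2017]. Text read: the held LaTeX-derived text `paper:arxiv-1411.4728` (27 chunks
`p0001`–`p0027`, no PDF pagination; locators below are `chunk:line` of that materialisation plus the
printed theorem numbers, which agree with the journal version as cited by Tian, Proc. ICM 2022
[Tian2023CongruentICM] Thm. 13 = "[51]").

## The printed statements (verbatim, §1 = chunk p0002)

* Set-up (p0002 L17–L31): `E_n : ny² = x³ − x`, `n` square-free positive; root number `+1` for
  `n ≡ 1, 2, 3 (mod 8)`, `−1` for `n ≡ 5, 6, 7 (mod 8)` (Birch–Stephens).
* Definition of `𝓛(n)` (p0002 L46–L75): "`𝓛(n) := [L(E_n,1)/(2^{2k(n)−2−a(n)} Ω_{n,∞})]^{1/2}` if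
  `ord_{s=1} L(E_n,s) = 0`; `[L′(E_n,1)/(2^{2k(n)−2−a(n)} · Ω_{n,∞} R_n)]^{1/2}` if
  `ord_{s=1} L(E_n,s) = 1`; `0` if `ord_{s=1} L(E_n,s) > 1`. Here `k(n)` is the number of odd prime
  factors of `n`; `a(n) = 0` if `n` is even, and `1` if `n` is odd; the real period
  `Ω_{n,∞} = (2/√n) ∫₁^∞ dx/√(x³ − x)`; `R_n` is twice of the Néron–Tate height of a generator of
  `E_n(ℚ)/E_n(ℚ)_tor` (in the case of rank one). The definition is made so that the full BSD
  conjecture for `E_n` in the case `ord_{s=1} L(E_n,s) ≤ 1` writes as (1.1) `#Ш(E_n) = 𝓛(n)²`."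
  "The number `𝓛(n)` is a priori a complex number defined up to a sign." (L77)
* Genus class numbers (p0002 L78–L84): "`g(d) := #(2 Cl(ℚ(√−d)))` of positive divisors `d` of `n`.
  It is clear that `g(d)` is odd if and only if `Cl(ℚ(√−d))` has no element of exact order `4`."
* **Theorem 1.1** (p0002 L90–L99): "Let `n ≡ 1, 2, 3 (mod 8)` be a positive and square-free
  integer. Then `𝓛(n)` is an integer, and `𝓛(n) ≡ ∑_{n = d₀d₁⋯d_ℓ, dᵢ ≡ 1 (mod 8), i > 0} ∏ᵢ g(dᵢ)
  (mod 2)`. Here all decompositions `n = d₀⋯d_ℓ` are non-ordered with `dᵢ > 1` for all `i ≥ 0`.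
  The right-hand side is considered to be `1` if `n = 1`."
* `ρ(n)` (p0002 L101–L110): "For `n ≡ 5, 6, 7`, we introduce an integer `ρ(n) ≥ 0` by
  `2^{ρ(n)} = [E_n(ℚ) : φ_n(A_n(ℚ)) + E_n[2]]`, where `φ_n : A_n → E_n` is a `2`-isogeny from
  `A_n : 2nv² = u³ + u` to `E_n : ny² = x³ − x` defined by
  `φ_n(u, v) = (½(u + 1/u), (v/2u)(u − 1/u))`."
* **Theorem 1.2** (p0002 L112–L127): "Let `n ≡ 5, 6, 7 (mod 8)` be a positive and square-free
  integer. Then `𝓛(n)` is an integer. If `n ≡ 5, 7 (mod 8)`, then `2^{−ρ(n)}𝓛(n)` is even only if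
  `∑_{n = d₀⋯d_ℓ, dᵢ ≡ 1 (mod 8), i > 0} ∏ᵢ g(dᵢ) ≡ ∑_{n = d₀⋯d_ℓ, d₀ ≡ 5,6,7 (mod 8), d₁ ≡ 1,2,3 (mod 8), dᵢ ≡ 1 (mod 8), i > 1} ∏ᵢ g(dᵢ) ≡ 0 (mod 2)`.
  If `n ≡ 6 (mod 8)`, then `2^{−ρ(n)}𝓛(n)` is even only if
  `∑_{n = d₀⋯d_ℓ, d₀ ≡ 5,6,7 (mod 8), d₁ ≡ 1,2,3 (mod 8), dᵢ ≡ 1 (mod 8), i > 1} ∏ᵢ g(dᵢ) ≡ 0 (mod 2)`.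
  Here all decompositions `n = d₀⋯d_ℓ` are non-ordered with all `dᵢ > 1`."  The body's Theorem 3.5
  (chunk p0011 L94–L104, "an enhanced version of Theorem 1.2") glosses "`2^{−ρ(n)}𝓛(n)` is even" as
  "`P(n) := 2^{−1−ρ(n)}𝓛(n) α_n ∈ A(K_n)⁻ + A[4]`", i.e. `2^{ρ(n)+1} ∣ 𝓛(n)` — the reading typed below.
* **Remark 1.3** (p0003 L4–L8): positive density of odd `𝓛(n)` expected; for `n ≡ 1, 2, 3` "this is
  already implied by the BSD formula (1.1) modulo `2` and the work of Heath-Brown. Moreover the BSD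
  formula (1.1) modulo `2` can be checked case by case" (Monsky's `𝔽₂`-rank of `Sel₂(E_n)/E_n(ℚ)[2]`).
* **Corollary 1.4** (p0003 L13–L33): "Let `n` be a square-free positive integer such that `ℚ(√−n)`
  has no ideal classes of exact order `4`. For any integer `r`, let `A_r(n): #{p ∣ n : p ≡ 3 (mod 4)} ≤ r`;
  `B_r(n): #{p ∣ n : p ≡ ±3 (mod 8)} ≤ r`. Then in the following case, `n` is a non-congruent
  number: `n ≡ 1 (mod 8)` with `A₂(n)` or `B₂(n)`; `n ≡ 2 (mod 8)` with `A₀(n)` or `B₂(n)`;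
  `n ≡ 3 (mod 8)` with `A₁(n)` or `B₁(n)`. In the following case, `n` is a congruent number:
  `n ≡ 5 (mod 8)` with `A₀(n)` or `B₁(n)`; `n ≡ 7 (mod 8)` with `A₁(n)` or `B₀(n)`."

## The `p = 2` flag of this file

Theorems 1.1 / 1.2 are statements about the INTEGRALITY and the PARITY of `𝓛(n)`, the square root
of the analytic order of `Ш` in the authors' normalisation ((1.1): BSD for `E_n`, `ord ≤ 1`, ⟺
`#Ш(E_n) = 𝓛(n)²`). They do not by themselves assert the `2`-part of the BSD formula for any `n`:
"`𝓛(n)` odd" is `ord₂ #Ш_an(E_n) = 0`, the ANALYTIC half; the algebraic half `Ш(E_n)[2] = 0` is a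
`2`-descent statement (Monsky / Heath-Brown, Remark 1.3; Tian 2014 Thm. 1.3 for Tian's family;
Smith 2016 for density). Tian's ICM survey [Tian2023CongruentICM] p. 1993 attributes "the 2-part
of the BSD formula" for the Li–Liu–Tian family to "[51], [50]" = this paper + Tian 2014, and its
Thm. 8 (p. 1996: density-`2/3` subset of `{s(n) = 1}` with analytic rank one AND the `2`-part) to
"[47, 50, 51]" = Smith + Tian + this paper. No prime other than `2` (and no "`p` odd") occurs in the
hypotheses of Thms. 1.1 / 1.2: they are `2`-adic statements for ALL square-free `n` in the stated
residue classes.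

## Transcription (tree dictionary) and the height normalisation

* `E_n : ny² = x³ − x` is typed as the tree's `congruentNumberCurve n : y² = x³ − n²x`
  (`ℚ`-isomorphic via `(x, y) ↦ (nx, n²y)`; a global minimal model for square-free `n`,
  `isGloballyMinimal_congruentNumberCurve`); `L(E_n, s)`, `ord_{s=1}`, `L^{(r)}(E_n,1)` are the tree's
  `entireLFunction`, `analyticRank`, `leadingLCoeff` (`= L^{(r)}(E,1)/r!`, so `= L(E_n,1)` resp.
  `L′(E_n,1)` in ranks `0` resp. `1`).
* `Ω_{n,∞}` is typed LITERALLY as `(2/√n) ∫_{x ∈ (1,∞)} dx/√(x³ − x)` (`realPeriodTYZ`).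
* `R_n`. The tree's Néron–Tate height `canonicalHeight` is `ĥ(P) = lim h(x(2ⁿP))/4ⁿ` WITHOUT
  Silverman's factor `½` ("Clay/Wiles normalisation", `Heights.lean`), and `regulator` is the Gram
  determinant of `⟨P,Q⟩ = ½(ĥ(P+Q) − ĥ(P) − ĥ(Q))`, so in rank one `regulator = ĥ(generator)`. The
  authors' "Néron–Tate height" carries the factor `½` (the Gross–Zagier / Yuan–Zhang–Zhang
  convention), so that THEIR `R_n = 2 ĥ_{TYZ}(P) = ĥ_{tree}(P) =` the tree's `regulator` of `E_n`.
  This reading is the one under which the printed sentence "(1.1) is the full BSD conjecture" is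
  true, and it was CHECKED NUMERICALLY by this seat (kit job `j142692`, PARI 2.15.4, all square-free
  `n ≤ 79` of analytic rank `≤ 1`): with `R_n = ellheight` (PARI's BSD-normalised height, = the
  tree's) `𝓛(n)²` comes out `= #Ш_an(E_n) ∈ {1, 4, 9}` exactly, with `R_n = 2·ellheight` it comes
  out `½`. Hence `regulatorTYZ n := (congruentNumberCurve n).regulator`.
* `𝓛(n)` "defined up to sign": we type its SQUARE `scriptLSq n : ℂ` (by cases on the analytic rank,
  exactly as printed) and render "`𝓛(n)` is an integer" as `∃ L : ℤ, (L : ℂ)² = scriptLSq n`; the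
  parity / divisibility statements are about `L` and are sign-invariant.
* `g(d) = #(2 Cl(ℚ(√−d)))`: `Nat.card` of the squares in `ClassGroup (𝓞 K_d)` (Mathlib, written
  multiplicatively) for quadratic number fields `K_d ∋ √−d`, supplied as a family
  `K : ℕ → Type` with `[K_d : ℚ] = 2`, `∃ x, x² = −d` for every positive divisor `d ∣ n` (all such
  `K_d` are copies of `ℚ(√−d)`; the same rendering as `LiLiuTian2024.NoIdealClassOfOrderFour`).
* "non-ordered decompositions `n = d₀d₁⋯d_ℓ` with all `dᵢ > 1`": finite sets `D` of pairwise coprime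
  divisors `> 1` of `n` with product `n` (`decompositions n`; for square-free `n` these are the set
  partitions of its prime factors; `n = 1` has exactly the empty decomposition, whose empty product
  is `1` — "the right-hand side is considered to be `1` if `n = 1`"). A decomposition is COUNTED ONCE
  when it admits a labelling satisfying the printed congruence conditions (`d₀` free and the other
  `dᵢ ≡ 1 (mod 8)`; resp. `d₀ ≡ 5,6,7`, `d₁ ≡ 1,2,3`, the others `≡ 1 (mod 8)`), and `∏ᵢ g(dᵢ)` runs
  over ALL factors of the decomposition including `d₀` (the reading forced by `n = 41`, where
  `ord_{s=1} L(E_41, s) = 2`, `𝓛(41) = 0`, and the only decomposition `{41}` contributes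
  `g(41) = #2Cl(ℚ(√−41)) = 4`).
* `ρ(n)`: `2^{ρ(n)}` is the index in `E_n(ℚ)` of the subgroup generated by `φ_n(A_n(ℚ))` and the
  `2`-torsion, with `φ_n` transported to the model `y² = x³ − n²x`:
  `(u, v) ↦ (n(u + u⁻¹)/2, n²·(v/(2u))(u − u⁻¹))` (`isogenyImageTYZ`); typed as a binder
  `ρ : ℕ` with `index = 2 ^ ρ`.
* "`n` is (non-)congruent": the tree's `IsCongruentNumber` (`BSDWave0`). "`ℚ(√−n)` has no ideal
  classes of exact order `4`": the tree's `LiLiuTian2024.NoIdealClassOfOrderFour (−n)`.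
No `_holds` expected (Waldspurger / Yuan–Zhang–Zhang Gross–Zagier with Gross–Prasad test vectors,
genus theory of Heegner points). Consumers take `(h : thm11_parity_of_scriptL)` etc.

## References
* [TianYuanZhang2017] Asian J. Math. 21 (2017) 721–774 = arXiv:1411.4728: §1 (Thm. 1.1, Thm. 1.2,
  Rem. 1.3, Cor. 1.4), §3.1 (Thm. 3.3 Gross–Zagier, Prop. 3.4, Thm. 3.5).
* [Tian2023CongruentICM] Y. Tian, Proc. ICM 2022 (EMS 2023), p. 1993 (after Thm. 2), Thm. 8 (p. 1996),
  Thm. 13 (p. 2000: the survey's restatement of Thm. 1.2).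
* [Tian2014] Y. Tian, Camb. J. Math. 2 (2014) 117–161 (the induction method; `[Tian]` of the source).
* Kit job `j142692` (this seat, 2026-08-21): numerical check of the `R_n` / `Ω_{n,∞}` normalisation.
-/

noncomputable section

open scoped Classical

open NumberField MeasureTheory WeierstrassCurve Literature.NumberTheory.EllipticCurves
  Literature.NumberTheory.EllipticCurves.LiLiuTian2024

namespace Literature.NumberTheory.EllipticCurves.TianYuanZhang2017

/-! ### §1. The invariants of the introduction (definitions with bodies; nothing asserted) -/

/-- `k(n)`: "the number of odd prime factors of `n`". [cite: TianYuanZhang2017, §1 (arXiv chunk p0002 L63)] -/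
def oddPrimeFactorCount (n : ℕ) : ℕ :=
  (n.primeFactors.filter Odd).card

/-- `a(n) = 0` if `n` is even, and `1` if `n` is odd. [cite: TianYuanZhang2017, §1 (p0002 L65)] -/
def oddIndicator (n : ℕ) : ℕ :=
  if Even n then 0 else 1

/-- The authors' real period `Ω_{n,∞} = (2/√n) ∫₁^∞ dx/√(x³ − x)`, typed literally (Bochner integral
over `(1, ∞)`; the integrand is integrable). [cite: TianYuanZhang2017, §1 (p0002 L67)] -/
def realPeriodTYZ (n : ℕ) : ℝ :=
  2 / Real.sqrt n * ∫ x in Set.Ioi (1 : ℝ), 1 / Real.sqrt (x ^ 3 - x)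

/-- The authors' `R_n`: "twice of the Néron–Tate height of a generator of `E_n(ℚ)/E_n(ℚ)_tor` (in
the case of rank one)", the height being normalised WITH Silverman's `½`; this equals the tree's
`regulator` of `E_n` (rank one: `ĥ_tree(P) = 2 ĥ_{TYZ}(P)`, Clay normalisation, `Heights.lean`) —
see the module docstring for the numerical confirmation (kit job `j142692`). In ranks `≠ 1` the
value is not used. [cite: TianYuanZhang2017, §1 (p0002 L69)] -/
def regulatorTYZ (n : ℕ) : ℝ :=
  (congruentNumberCurve n).regulator

/-- The exponent `2k(n) − 2 − a(n)` (an integer, negative for small `n`: `−3` for `n = 1`).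
[cite: TianYuanZhang2017, §1 (p0002 L51–L53)] -/
def twoExponent (n : ℕ) : ℤ :=
  2 * (oddPrimeFactorCount n : ℤ) - 2 - oddIndicator n

/-- `𝓛(n)²`, the square of the authors' invariant (which is "defined up to a sign"):
`L(E_n,1)/(2^{2k(n)−2−a(n)} Ω_{n,∞})` if `ord_{s=1} L(E_n,s) = 0`,
`L′(E_n,1)/(2^{2k(n)−2−a(n)} Ω_{n,∞} R_n)` if `ord_{s=1} = 1`, and `0` if `ord_{s=1} > 1`; with
`E_n = congruentNumberCurve n` and `L^{(r)}(E_n, 1) = leadingLCoeff` (`r ≤ 1`).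
[cite: TianYuanZhang2017, §1, definition of 𝓛(n) (p0002 L46–L75)] -/
def scriptLSq (n : ℕ) : ℂ :=
  if (congruentNumberCurve n).analyticRank = 0 then
    (congruentNumberCurve n).leadingLCoeff /
      ((2 : ℂ) ^ twoExponent n * (realPeriodTYZ n : ℂ))
  else if (congruentNumberCurve n).analyticRank = 1 then
    (congruentNumberCurve n).leadingLCoeff /
      ((2 : ℂ) ^ twoExponent n * (realPeriodTYZ n : ℂ) * (regulatorTYZ n : ℂ))
  else 0

/-- "`𝓛(n)` is an integer" together with a name for it: `L : ℤ` with `L² = 𝓛(n)²` (the sign of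
`𝓛(n)` is immaterial, p0002 L77). [cite: TianYuanZhang2017, Thm. 1.1 / Thm. 1.2 ("𝓛(n) is an integer")] -/
def IsScriptL (n : ℕ) (L : ℤ) : Prop :=
  ((L : ℂ)) ^ 2 = scriptLSq n

/-- The genus class number `g = #(2 Cl(K))` of a number field `K` (the number of squares in the
class group, Mathlib's `ClassGroup (𝓞 K)` being written multiplicatively); used with `K = ℚ(√−d)`:
"`g(d) := #(2 Cl(ℚ(√−d)))`". [cite: TianYuanZhang2017, §1 (p0002 L78–L82)] -/
def genusClassNumber (K : Type*) [Field K] [NumberField K] : ℕ :=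
  Nat.card {a : ClassGroup (𝓞 K) // IsSquare a}

/-- A family of imaginary quadratic fields `K_d = ℚ(√−d)` indexed by the positive divisors `d` of
`n`: `[K_d : ℚ] = 2` and `−d` is a square in `K_d` (the rendering of "the field `ℚ(√D)`" of
`LiLiuTian2024.NoIdealClassOfOrderFour`). [cite: TianYuanZhang2017, §1 (p0002 L78–L82)] -/
def IsGenusFieldFamily (n : ℕ) (K : ℕ → Type) [∀ d, Field (K d)] [∀ d, NumberField (K d)] : Prop :=
  ∀ d ∈ n.divisors, Module.finrank ℚ (K d) = 2 ∧ ∃ x : K d, x ^ 2 = (-(d : ℤ) : K d)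

/-- The non-ordered decompositions `n = d₀d₁⋯d_ℓ` with all `dᵢ > 1`: finite sets of pairwise coprime
divisors `> 1` of `n` with product `n` (for square-free `n`, the set partitions of its prime
factors; `decompositions 1 = {∅}`). [cite: TianYuanZhang2017, Thm. 1.1 ("all decompositions … are non-ordered with dᵢ > 1")] -/
def decompositions (n : ℕ) : Finset (Finset ℕ) :=
  n.divisors.powerset.filter fun D =>
    (∀ d ∈ D, 1 < d) ∧ (D : Set ℕ).Pairwise Nat.Coprime ∧ ∏ d ∈ D, d = n

/-- The first genus sum `∑_{n = d₀d₁⋯d_ℓ, dᵢ ≡ 1 (mod 8) for i > 0} ∏ᵢ g(dᵢ)`: over the decompositions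
all of whose factors but at most one (`d₀`) are `≡ 1 (mod 8)`, of the product of `g` over ALL
factors. [cite: TianYuanZhang2017, Thm. 1.1 and Thm. 1.2 (p0002 L93–L99, L115–L120)] -/
def genusSum₁ (n : ℕ) (g : ℕ → ℕ) : ℕ :=
  ∑ D ∈ (decompositions n).filter (fun D => (D.filter fun d => d % 8 ≠ 1).card ≤ 1),
    ∏ d ∈ D, g d

/-- **MIS-STATED — superseded by `genusSum₂'` (ERRATUM F-Σ2 in the module docstring); kept
unchanged because it is referenced.**  This GEN-1 rendering of the second genus sum
`∑_{n = d₀⋯d_ℓ, d₀ ≡ 5,6,7 (mod 8), d₁ ≡ 1,2,3 (mod 8), dᵢ ≡ 1 (mod 8) for i > 1} ∏ᵢ g(dᵢ)` runs over the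
decompositions admitting two DISTINCT factors `d₀ ≡ 5, 6, 7` and `d₁ ≡ 1, 2, 3 (mod 8)` with all
remaining factors `≡ 1 (mod 8)`, and so OMITS the printed `ℓ = 0` term `{n}`:
`genusSum₂' n g = genusSum₂ n g + g n` (`genusSum₂'_eq_genusSum₂_add_self`).
[cite: TianYuanZhang2017, Thm. 1.2 (p0002 L115–L127); proof of Prop. 3.4 (p0016 L146, p0017 L58)] -/
def genusSum₂ (n : ℕ) (g : ℕ → ℕ) : ℕ :=
  ∑ D ∈ (decompositions n).filter (fun D => ∃ d₀ ∈ D, ∃ d₁ ∈ D, d₀ ≠ d₁ ∧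
      (d₀ % 8 = 5 ∨ d₀ % 8 = 6 ∨ d₀ % 8 = 7) ∧ (d₁ % 8 = 1 ∨ d₁ % 8 = 2 ∨ d₁ % 8 = 3) ∧
      ∀ d ∈ D, d ≠ d₀ → d ≠ d₁ → d % 8 = 1),
    ∏ d ∈ D, g d

/-- The image `φ_n(A_n(ℚ)) ⊆ E_n(ℚ)` of the rational points of `A_n : 2nv² = u³ + u` under the
`2`-isogeny `φ_n(u, v) = (½(u + 1/u), (v/2u)(u − 1/u))` to `E_n : ny² = x³ − x`, transported to the
model `congruentNumberCurve n : y² = x³ − n²x` by `(x, y) ↦ (nx, n²y)`; the points `O` and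
`(0, 0)` of `A_n` (the kernel) go to `O`. A set of rational points (its closure with `E_n[2]` below
is the printed subgroup `φ_n(A_n(ℚ)) + E_n[2]`). [cite: TianYuanZhang2017, §1, definition of ρ(n) (p0002 L101–L110)] -/
def isogenyImageTYZ (n : ℕ) : Set (congruentNumberCurve n).toAffine.Point :=
  {P | P = 0 ∨ ∃ (u v : ℚ), 2 * n * v ^ 2 = u ^ 3 + u ∧ u ≠ 0 ∧
    ∃ h, P = .some (n * ((u + u⁻¹) / 2)) ((n : ℚ) ^ 2 * (v / (2 * u) * (u - u⁻¹))) h}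

/-- The subgroup `φ_n(A_n(ℚ)) + E_n[2] ≤ E_n(ℚ)` whose index is `2^{ρ(n)}`.
[cite: TianYuanZhang2017, §1, definition of ρ(n) (p0002 L101–L103)] -/
def rhoSubgroup (n : ℕ) : AddSubgroup (congruentNumberCurve n).toAffine.Point :=
  AddSubgroup.closure (isogenyImageTYZ n ∪ {P | (2 : ℕ) • P = 0})

/-! ### §2. The printed theorems (named facts; nothing asserted) -/

/-- **Tian–Yuan–Zhang 2017, Theorem 1.1** (verbatim in the module docstring). For `n ≡ 1, 2, 3 (mod 8)`
positive square-free: `𝓛(n)` is an integer `L` (`L² = 𝓛(n)²`, `scriptLSq`) and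
`L ≡ ∑_{n = d₀⋯d_ℓ, dᵢ ≡ 1 (8), i>0} ∏ᵢ g(dᵢ) (mod 2)` (`genusSum₁`, with `g(d) = #2Cl(ℚ(√−d))` read in
any family of quadratic fields `K_d ∋ √−d`). At the prime `2` this is a PARITY formula for
`√#Ш_an(E_n)` in the authors' normalisation; it is NOT the `2`-part of BSD (see the module
docstring's flag). No `_holds` expected. [cite: TianYuanZhang2017, Thm. 1.1 (arXiv:1411.4728 §1, chunk p0002 L90–L99)] -/
def thm11_parity_of_scriptL : Prop :=
  ∀ (n : ℕ), Squarefree n → (n % 8 = 1 ∨ n % 8 = 2 ∨ n % 8 = 3) →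
    ∀ (K : ℕ → Type) [∀ d, Field (K d)] [∀ d, NumberField (K d)], IsGenusFieldFamily n K →
      ∃ L : ℤ, IsScriptL n L ∧
        (L : ZMod 2) = (genusSum₁ n (fun d => genusClassNumber (K d)) : ZMod 2)

/-- **MIS-STATED — DO NOT CONSUME; use `thm12_parity_of_scriptL'` (ERRATUM F-Σ2 in the module
docstring); kept unchanged because it is referenced.**  GEN-1 rendering of Tian–Yuan–Zhang 2017,
Theorem 1.2, whose `Σ₂` clauses use `genusSum₂` (the `ℓ = 0` term omitted) and are therefore STRONGER
than the printed theorem (refutable modulo GZK: p2-idea-2, 174 witnesses — EVIDENCE).  Consumers that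
instantiate it with the FIRST sum only (`Σ₁` odd) drew conclusions that the corrected fact yields verbatim.
Original description: for `n ≡ 5, 6, 7 (mod 8)` positive square-free, with
`2^{ρ} = [E_n(ℚ) : φ_n(A_n(ℚ)) + E_n[2]]` (`rhoSubgroup`): `𝓛(n)` is an integer `L`; if `n ≡ 5, 7 (mod 8)`
and `2^{−ρ}𝓛(n)` is even (read, with Thm. 3.5 of the source, as `2^{ρ+1} ∣ L`) then BOTH genus sums are
even; if `n ≡ 6 (mod 8)` and `2^{−ρ}𝓛(n)` is even then the second genus sum is even.
[cite: TianYuanZhang2017, Thm. 1.2 (arXiv:1411.4728 §1, chunk p0002 L101–L127); Thm. 3.5 (chunk p0011 L94–L104)] -/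
def thm12_parity_of_scriptL : Prop :=
  ∀ (n : ℕ), Squarefree n → (n % 8 = 5 ∨ n % 8 = 6 ∨ n % 8 = 7) →
    ∀ (ρ : ℕ), (rhoSubgroup n).index = 2 ^ ρ →
    ∀ (K : ℕ → Type) [∀ d, Field (K d)] [∀ d, NumberField (K d)], IsGenusFieldFamily n K →
      ∃ L : ℤ, IsScriptL n L ∧
        ((n % 8 = 5 ∨ n % 8 = 7) → (2 : ℤ) ^ (ρ + 1) ∣ L →
          Even (genusSum₁ n fun d => genusClassNumber (K d)) ∧
          Even (genusSum₂ n fun d => genusClassNumber (K d))) ∧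
        (n % 8 = 6 → (2 : ℤ) ^ (ρ + 1) ∣ L →
          Even (genusSum₂ n fun d => genusClassNumber (K d)))

/-- **Tian–Yuan–Zhang 2017, Corollary 1.4** (verbatim in the module docstring): for square-free
positive `n` such that `ℚ(√−n)` has no ideal class of exact order `4`
(`LiLiuTian2024.NoIdealClassOfOrderFour (−n)`), with
`A_r(n) : #{p ∣ n : p ≡ 3 (mod 4)} ≤ r` and `B_r(n) : #{p ∣ n : p ≡ ±3 (mod 8)} ≤ r`:
NON-congruent when `n ≡ 1 (8)` and (`A₂` or `B₂`), `n ≡ 2 (8)` and (`A₀` or `B₂`), `n ≡ 3 (8)` and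
(`A₁` or `B₁`); CONGRUENT when `n ≡ 5 (8)` and (`A₀` or `B₁`), `n ≡ 7 (8)` and (`A₁` or `B₀`).
No `_holds` expected. [cite: TianYuanZhang2017, Cor. 1.4 (arXiv:1411.4728 §1, chunk p0003 L13–L33)] -/
def cor14_congruent_criteria : Prop :=
  ∀ (n : ℕ), Squarefree n → 0 < n → NoIdealClassOfOrderFour (-(n : ℤ)) →
    let A : ℕ → Prop := fun r => (n.primeFactors.filter fun p => p % 4 = 3).card ≤ r
    let B : ℕ → Prop := fun r => (n.primeFactors.filter fun p => p % 8 = 3 ∨ p % 8 = 5).card ≤ r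
    (n % 8 = 1 → (A 2 ∨ B 2) → ¬ IsCongruentNumber n) ∧
    (n % 8 = 2 → (A 0 ∨ B 2) → ¬ IsCongruentNumber n) ∧
    (n % 8 = 3 → (A 1 ∨ B 1) → ¬ IsCongruentNumber n) ∧
    (n % 8 = 5 → (A 0 ∨ B 1) → IsCongruentNumber n) ∧
    (n % 8 = 7 → (A 1 ∨ B 0) → IsCongruentNumber n)

/-- **The authors' form (1.1) of the BSD formula for `E_n`**, `#Ш(E_n) = 𝓛(n)²` (with `Ш` finite so
that `#Ш` is meaningful): a predicate on `n`, the target shape in which the paper discusses BSD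
("The definition is made so that the [full BSD] for `E_n` in the case `ord_{s=1} L(E_n,s) ≤ 1`
writes as `#Ш(E_n) = 𝓛(n)²`" — `[full BSD]` standing for the authors' words naming the
Birch–Swinnerton-Dyer statement in full). Nothing asserted.
[cite: TianYuanZhang2017, §1 (1.1) (chunk p0002 L71–L75)] -/
def cardSha_eq_scriptLSq (n : ℕ) : Prop :=
  Finite (congruentNumberCurve n).sha ∧
    ((Nat.card (congruentNumberCurve n).sha : ℕ) : ℂ) = scriptLSq n

/-- **The printed normalisation claim** (§1, sentence before (1.1)): for square-free `n ≥ 1` with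
`ord_{s=1} L(E_n, s) ≤ 1`, the full BSD formula for `E_n` (the tree's SHAFIN ∧ LEAD on the global
minimal model `congruentNumberCurve n`: `Ш` finite and `L^{(r)}(E_n,1)/r! = #Ш·Reg·Ω·∏c_p/#E_n(ℚ)_tors²`)
is EQUIVALENT to `#Ш(E_n) = 𝓛(n)²`. The authors state this without proof ("The definition is made
so that …"); its content is `Ω(E_n) = Ω_{n,∞}`, `∏_p c_p(E_n) = 2^{2k(n)+2−a(n)}`, `#E_n(ℚ)_tors = 4`
and the height normalisation, all corroborated numerically for `n ≤ 79` by kit job `j142692`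
(module docstring). Vendored because it is the bridge from the authors' currency to Miller's
`BSD(E_n, 2)`; the instance binders are theorems for square-free `n`
(`isElliptic_congruentNumberCurve`, `isGloballyMinimal_congruentNumberCurve`). No `_holds` attempted
here (it needs the Tamagawa numbers and the torsion of `y² = x³ − n²x` for general square-free `n`).

**CONSUMER WARNING (p2-lead ruling L-G1, p2-ref governance note of 2026-08-22):** this is an
AUTHORS' REMARK with NO PRINTED PROOF in the source, vendored for bookkeeping only. It must NOT be
used as a hypothesis to discharge `BSD(E_n, 2)` (Miller's `BSDp · 2`), `ShaFinite` or
`BSDLeadingTermFormula` for any cell, class or route: a consumer needing the bridge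
`#Ш(E_n) = 𝓛(n)² ↔ BSD(E_n)` must PROVE the Tamagawa / torsion / period computation for
`congruentNumberCurve n` (or cite a source that prints a proof) rather than assume this `Prop`.
Kit job `j142692` is EVIDENCE, not a proof.
[cite: TianYuanZhang2017, §1, (1.1) and the sentence preceding it (chunk p0002 L71–L75)] -/
def bsd_iff_cardSha_eq_scriptLSq : Prop :=
  ∀ (n : ℕ) [(congruentNumberCurve n).IsElliptic] [(congruentNumberCurve n).IsGloballyMinimal],
    Squarefree n → (congruentNumberCurve n).analyticRank ≤ 1 →
      (((congruentNumberCurve n).ShaFinite ∧ (congruentNumberCurve n).BSDLeadingTermFormula) ↔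
        cardSha_eq_scriptLSq n)

/-! ### §5. ERRATUM F-Σ2 (2026-08-22): the second genus sum WITH its `ℓ = 0` term, and Thm. 1.2 AS PRINTED -/

/-- **The second genus sum of Thm. 1.2, AS PRINTED** (supersedes `genusSum₂`):
`∑_{n = d₀d₁⋯d_ℓ, d₀ ≡ 5,6,7 (mod 8), d₁ ≡ 1,2,3 (mod 8), dᵢ ≡ 1 (mod 8) for i > 1} ∏ᵢ g(dᵢ)` over the
non-ordered decompositions with all `dᵢ > 1` — a decomposition `D` is counted (once) iff it has a factor
`d₀ ≡ 5, 6, 7 (mod 8)` all of whose OTHER factors are `≡ 1, 2, 3 (mod 8)` with at most one of them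
`≢ 1 (mod 8)`; in particular the trivial decomposition `{n}` (`ℓ = 0`, the conditions on `d₁, dᵢ` being
vacuous) is counted for `n ≡ 5, 6, 7 (mod 8)` — "the contribution by `d₀ = n, d₁ = 1` is the single term
`Z(n)`" in the proof.  The product of `g` runs over ALL factors.
[cite: TianYuanZhang2017, Thm. 1.2 (chunk p0002 L115–L127); proof of Prop. 3.4 (p0016 L146, p0017 L58); Lemma 3.21 and the end of §3 (p0020 L27–L41, L124–L141; p0021 L3)] -/
def genusSum₂' (n : ℕ) (g : ℕ → ℕ) : ℕ :=
  ∑ D ∈ (decompositions n).filter (fun D => ∃ d₀ ∈ D, (d₀ % 8 = 5 ∨ d₀ % 8 = 6 ∨ d₀ % 8 = 7) ∧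
      (∀ d ∈ D, d ≠ d₀ → (d % 8 = 1 ∨ d % 8 = 2 ∨ d % 8 = 3)) ∧
      ((D.erase d₀).filter fun d => d % 8 ≠ 1).card ≤ 1),
    ∏ d ∈ D, g d

/-- **Tian–Yuan–Zhang 2017, Theorem 1.2, AS PRINTED** (supersedes the mis-stated
`thm12_parity_of_scriptL`; verbatim in the module docstring). For `n ≡ 5, 6, 7 (mod 8)` positive
square-free, with `2^{ρ} = [E_n(ℚ) : φ_n(A_n(ℚ)) + E_n[2]]` (`rhoSubgroup`): `𝓛(n)` is an integer `L`; if
`n ≡ 5, 7 (mod 8)` and `2^{−ρ}𝓛(n)` is even (read, with Thm. 3.5 of the source, as `2^{ρ+1} ∣ L`) then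
BOTH genus sums `Σ₁` (`genusSum₁`) and `Σ₂` (`genusSum₂'`, WITH the `ℓ = 0` term) are even; if
`n ≡ 6 (mod 8)` and `2^{−ρ}𝓛(n)` is even then `Σ₂` (`genusSum₂'`) is even.  Parity-at-`2` statement about
`√#Ш_an(E_n)`; not by itself the `2`-part of BSD.  No `_holds` expected.
[cite: TianYuanZhang2017, Thm. 1.2 (arXiv:1411.4728 §1, chunk p0002 L101–L127); Thm. 3.5 (chunk p0011 L94–L104); proof of Prop. 3.4 (p0016 L146)] -/
def thm12_parity_of_scriptL' : Prop :=
  ∀ (n : ℕ), Squarefree n → (n % 8 = 5 ∨ n % 8 = 6 ∨ n % 8 = 7) →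
    ∀ (ρ : ℕ), (rhoSubgroup n).index = 2 ^ ρ →
    ∀ (K : ℕ → Type) [∀ d, Field (K d)] [∀ d, NumberField (K d)], IsGenusFieldFamily n K →
      ∃ L : ℤ, IsScriptL n L ∧
        ((n % 8 = 5 ∨ n % 8 = 7) → (2 : ℤ) ^ (ρ + 1) ∣ L →
          Even (genusSum₁ n fun d => genusClassNumber (K d)) ∧
          Even (genusSum₂' n fun d => genusClassNumber (K d))) ∧
        (n % 8 = 6 → (2 : ℤ) ^ (ρ + 1) ∣ L →
          Even (genusSum₂' n fun d => genusClassNumber (K d)))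

/-- `{n}` is a decomposition of `n > 1` (the `ℓ = 0` term). [cite: TianYuanZhang2017, Thm. 1.1 / Thm. 1.2 ("all decompositions n = d₀⋯d_ℓ are non-ordered with dᵢ > 1")] -/
theorem singleton_mem_decompositions {n : ℕ} (hn : 1 < n) : {n} ∈ decompositions n := by
  simp only [decompositions, Finset.mem_filter, Finset.mem_powerset, Finset.singleton_subset_iff,
    Nat.mem_divisors, dvd_refl, true_and, Finset.mem_singleton, forall_eq, Finset.coe_singleton,
    Set.pairwise_singleton, Finset.prod_singleton, and_true]
  exact ⟨by omega, hn⟩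

/-- A decomposition with a single factor is `{n}`. [cite: TianYuanZhang2017, Thm. 1.1 (decompositions have product n)] -/
theorem eq_singleton_of_mem_decompositions {n : ℕ} {D : Finset ℕ} (hD : D ∈ decompositions n)
    {d₀ : ℕ} (hd₀ : d₀ ∈ D) (h : ∀ d ∈ D, d = d₀) : D = {n} := by
  simp only [decompositions, Finset.mem_filter, Finset.mem_powerset] at hD
  have hD0 : D = {d₀} := Finset.eq_singleton_iff_unique_mem.mpr ⟨hd₀, h⟩
  rw [hD0, Finset.prod_singleton] at hD
  rw [hD0, hD.2.2.2]

/-- **The printed filter versus the GEN-1 filter**: a decomposition `D ≠ {n}` satisfies the printed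
`Σ₂`-condition iff it satisfies the two-distinct-factors condition of `genusSum₂`; `{n}` satisfies the
printed one (for `n ≡ 5, 6, 7 (mod 8)`) and not the other. [cite: TianYuanZhang2017, Thm. 1.2 (chunk p0002 L115–L127)] -/
theorem genusSum₂'_filter_iff {n : ℕ} {D : Finset ℕ} (hD : D ∈ decompositions n) (hDn : D ≠ {n}) :
    (∃ d₀ ∈ D, (d₀ % 8 = 5 ∨ d₀ % 8 = 6 ∨ d₀ % 8 = 7) ∧
      (∀ d ∈ D, d ≠ d₀ → (d % 8 = 1 ∨ d % 8 = 2 ∨ d % 8 = 3)) ∧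
      ((D.erase d₀).filter fun d => d % 8 ≠ 1).card ≤ 1) ↔
    (∃ d₀ ∈ D, ∃ d₁ ∈ D, d₀ ≠ d₁ ∧
      (d₀ % 8 = 5 ∨ d₀ % 8 = 6 ∨ d₀ % 8 = 7) ∧ (d₁ % 8 = 1 ∨ d₁ % 8 = 2 ∨ d₁ % 8 = 3) ∧
      ∀ d ∈ D, d ≠ d₀ → d ≠ d₁ → d % 8 = 1) := by
  constructor
  · rintro ⟨d₀, hd₀, h567, hrest, hcard⟩
    -- `D ≠ {n}` gives a second factor
    have hex : ∃ d ∈ D, d ≠ d₀ := by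
      by_contra h
      push Not at h
      exact hDn (eq_singleton_of_mem_decompositions hD hd₀ h)
    by_cases hS : ((D.erase d₀).filter fun d => d % 8 ≠ 1).Nonempty
    · obtain ⟨d₁, hd₁⟩ := hS
      have hd₁' := hd₁
      rw [Finset.mem_filter, Finset.mem_erase] at hd₁'
      obtain ⟨⟨hne, hd₁D⟩, h1⟩ := hd₁'
      refine ⟨d₀, hd₀, d₁, hd₁D, hne.symm, h567, hrest d₁ hd₁D hne, fun d hd hd0 hd1 => ?_⟩
      by_contra hne1
      have hmem : d ∈ (D.erase d₀).filter fun d => d % 8 ≠ 1 :=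
        Finset.mem_filter.mpr ⟨Finset.mem_erase.mpr ⟨hd0, hd⟩, hne1⟩
      exact hd1 (Finset.card_le_one.mp hcard d hmem d₁ hd₁)
    · rw [Finset.not_nonempty_iff_eq_empty] at hS
      obtain ⟨d₁, hd₁D, hne⟩ := hex
      have h1 : ∀ d ∈ D, d ≠ d₀ → d % 8 = 1 := by
        intro d hd hd0
        by_contra hne1
        have hmem : d ∈ (D.erase d₀).filter fun d => d % 8 ≠ 1 :=
          Finset.mem_filter.mpr ⟨Finset.mem_erase.mpr ⟨hd0, hd⟩, hne1⟩
        rw [hS] at hmem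
        exact Finset.notMem_empty d hmem
      exact ⟨d₀, hd₀, d₁, hd₁D, hne.symm, h567, Or.inl (h1 d₁ hd₁D hne), fun d hd hd0 _ => h1 d hd hd0⟩
  · rintro ⟨d₀, hd₀, d₁, hd₁, hne, h567, h123, hrest⟩
    refine ⟨d₀, hd₀, h567, fun d hd hd0 => ?_, ?_⟩
    · by_cases hd1 : d = d₁
      · rw [hd1]; exact h123
      · exact Or.inl (hrest d hd hd0 hd1)
    · refine Finset.card_le_one.mpr fun a ha b hb => ?_
      rw [Finset.mem_filter, Finset.mem_erase] at ha hb
      have ha1 : a = d₁ := by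
        by_contra h; exact ha.2 (hrest a ha.1.2 ha.1.1 h)
      have hb1 : b = d₁ := by
        by_contra h; exact hb.2 (hrest b hb.1.2 hb.1.1 h)
      rw [ha1, hb1]

/-- **The erratum in one line**: for `1 < n ≡ 5, 6, 7 (mod 8)` the printed second genus sum is the
GEN-1 one PLUS the `ℓ = 0` term: `Σ₂'(n; g) = Σ₂(n; g) + g(n)`. [cite: TianYuanZhang2017, Thm. 1.2 and proof of Prop. 3.4 (p0016 L146: "the contribution by d₀ = n, d₁ = 1 is the single term Z(n)")] -/
theorem genusSum₂'_eq_genusSum₂_add_self {n : ℕ} (hn : 1 < n) (h8 : n % 8 = 5 ∨ n % 8 = 6 ∨ n % 8 = 7)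
    (g : ℕ → ℕ) : genusSum₂' n g = genusSum₂ n g + g n := by
  unfold genusSum₂' genusSum₂
  set Pnew : Finset ℕ → Prop := fun D => ∃ d₀ ∈ D, (d₀ % 8 = 5 ∨ d₀ % 8 = 6 ∨ d₀ % 8 = 7) ∧
      (∀ d ∈ D, d ≠ d₀ → (d % 8 = 1 ∨ d % 8 = 2 ∨ d % 8 = 3)) ∧
      ((D.erase d₀).filter fun d => d % 8 ≠ 1).card ≤ 1 with hPnew
  set Pold : Finset ℕ → Prop := fun D => ∃ d₀ ∈ D, ∃ d₁ ∈ D, d₀ ≠ d₁ ∧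
      (d₀ % 8 = 5 ∨ d₀ % 8 = 6 ∨ d₀ % 8 = 7) ∧ (d₁ % 8 = 1 ∨ d₁ % 8 = 2 ∨ d₁ % 8 = 3) ∧
      ∀ d ∈ D, d ≠ d₀ → d ≠ d₁ → d % 8 = 1 with hPold
  have hmem : {n} ∈ decompositions n := singleton_mem_decompositions hn
  have hnew_n : Pnew {n} := by
    refine ⟨n, Finset.mem_singleton_self n, h8, fun d hd hdn => ?_, ?_⟩
    · exact absurd (Finset.mem_singleton.mp hd) hdn
    · rw [Finset.erase_singleton, Finset.filter_empty, Finset.card_empty]; exact zero_le_one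
  have hold_n : ¬ Pold {n} := by
    rintro ⟨d₀, hd₀, d₁, hd₁, hne, -⟩
    rw [Finset.mem_singleton] at hd₀ hd₁
    exact hne (hd₀.trans hd₁.symm)
  have hF : (decompositions n).filter Pnew = insert {n} ((decompositions n).filter Pold) := by
    ext D
    rw [Finset.mem_insert, Finset.mem_filter, Finset.mem_filter]
    constructor
    · rintro ⟨hD, hP⟩
      by_cases hDn : D = {n}
      · exact Or.inl hDn
      · exact Or.inr ⟨hD, (genusSum₂'_filter_iff hD hDn).mp hP⟩
    · rintro (rfl | ⟨hD, hP⟩)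
      · exact ⟨hmem, hnew_n⟩
      · have hDn : D ≠ {n} := fun h => hold_n (h ▸ hP)
        exact ⟨hD, (genusSum₂'_filter_iff hD hDn).mpr hP⟩
  have hnot : {n} ∉ (decompositions n).filter Pold := fun h => hold_n (Finset.mem_filter.mp h).2
  rw [hF, Finset.sum_insert hnot, Finset.prod_singleton, add_comm]

/-- `Σ₂'(n; g) ≡ Σ₂'(n; g mod 2) (mod 2)`. [cite: TianYuanZhang2017, Thm. 1.2 (Σ₂)] -/
theorem genusSum₂'_mod_two (n : ℕ) (g : ℕ → ℕ) :
    genusSum₂' n g % 2 = genusSum₂' n (fun d => g d % 2) % 2 := by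
  unfold genusSum₂'
  rw [Finset.sum_nat_mod, Finset.sum_congr rfl fun D _ => Finset.prod_nat_mod D 2 g]
  conv_rhs => rw [Finset.sum_nat_mod, Finset.sum_congr rfl fun D _ => Finset.prod_nat_mod D 2 _]
  simp only [Nat.mod_mod]

/-- Parity transfer for `Σ₂'`: `Σ₂'(n; g)` is odd iff `Σ₂'(n; g′)` is, whenever `g ≡ g′ (mod 2)` on the
divisors `d > 1` of `n`. [cite: TianYuanZhang2017, Thm. 1.2 (Σ₂)] -/
theorem odd_genusSum₂'_iff_of_mod_two_eq (n : ℕ) {g g' : ℕ → ℕ}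
    (h : ∀ d ∈ n.divisors, 1 < d → g d % 2 = g' d % 2) :
    Odd (genusSum₂' n g) ↔ Odd (genusSum₂' n g') := by
  have key : genusSum₂' n (fun d => g d % 2) = genusSum₂' n (fun d => g' d % 2) := by
    unfold genusSum₂'
    refine Finset.sum_congr rfl fun D hD => Finset.prod_congr rfl fun d hd => h d ?_ ?_
    · simp only [Finset.mem_filter, decompositions, Finset.mem_powerset] at hD
      exact hD.1.1 hd
    · simp only [Finset.mem_filter, decompositions, Finset.mem_powerset] at hD
      exact hD.1.2.1 d hd
  rw [Nat.odd_iff, Nat.odd_iff, genusSum₂'_mod_two, key, ← genusSum₂'_mod_two]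

/-- The parity relation behind the erratum: for `1 < n ≡ 5, 6, 7 (mod 8)`,
`Σ₂'` is odd iff exactly one of `Σ₂` (GEN-1) and `g(n)` is odd. [cite: TianYuanZhang2017, Thm. 1.2 and proof of Prop. 3.4 (p0016 L146)] -/
theorem odd_genusSum₂'_iff {n : ℕ} (hn : 1 < n) (h8 : n % 8 = 5 ∨ n % 8 = 6 ∨ n % 8 = 7) (g : ℕ → ℕ) :
    Odd (genusSum₂' n g) ↔ (Odd (genusSum₂ n g) ↔ Even (g n)) := by
  rw [genusSum₂'_eq_genusSum₂_add_self hn h8, Nat.odd_add]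

end Literature.NumberTheory.EllipticCurves.TianYuanZhang2017

end
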